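import Summits.ABC.ABC.Theorems.DefiniteXiFreyModularityCMCorner
import Summits.ABC.ABC.Theorems.DefiniteXiFreyModularityCDT
import Summits.ABC.ABC.Theorems.DefiniteXiFreyModularityStubNineTransfer
import HarnessLib

/-!
# Stub ideas for `stub_modThree` — ideator k = 3 · GENERATION 19 (family 3: probe the extremes —
"minimal counterexample forces a whole (3,5)-congruence component" + "perturbation from the PROVED
neighbour, ITERATED" + the extremal/height count that closes the door)

Companion to `STUB-IDEAS-stub_modThree-3.md` (g19).  Elaboration-only; every `theorem` below is PROVED
(no `sorry`); the `Prop`s `ChainToCubeLocus` / `FreyChainDoor` are the Diophantine DOOR of the line,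
typed so that a refuter can shoot at it — they are NOT proposed for staffing (see the .md: the door is a
rational point on a twisted modular threefold of general type; Taylor 2002 passes to a totally real field
exactly here).

Registered stub (line `Sketch`, L143, sha 21576c53…), verbatim:
`∀ W [W.IsElliptic] (ρ : ModPGaloisRep ℚ (ZMod 3) 2), W.IsTorsionGaloisRep 3 ρ →
   FramedRep.IsAbsolutelyIrreducible ρ → ρ.IsModular`.

T-A (iterated switching / reachability).  The skeleton consumes the stub ONCE (`hmod3` inside
`liftThree_of_stubs`), i.e. only to make a curve `W` with big mod-3 image `BCDT.IsModular`.  Along a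
"big-image edge" of the mod-3 / mod-5 congruence graph the registered R = T stubs (`stub_liftThree`,
`stub_liftFive`) and `stub_threeImpTwo` TRANSPORT `BCDT.IsModular` (L2, L3 below), and on the cube-`j`
locus (`Δ ∈ ℚ׳`, k1's `CubeBranch` = the CM/theta half, fact-free since `shimura1972…_holds` landed)
the stub needs no Langlands–Tunnell.  Hence (A) a (5,3,5)-chain from a Frey curve to the cube locus makes
the Frey curve modular with NO octahedral input and NO `stub_switch`.  The .md explains why the chain
space is of general type (only the 5-steps move the cube class `[Δ] ∈ ℚˣ/ℚ׳`) and why this is Taylor's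
potential-modularity mechanism with `F = ℚ` — the printed reason the line does not close over `ℚ`.
-/

set_option linter.dupNamespace false

noncomputable section

open scoped MatrixGroups
open Literature.NumberTheory.EllipticCurves
open Literature.NumberTheory.Automorphic
open Literature.NumberTheory.Automorphic.BCDT
open Literature.NumberTheory.GaloisRepresentations
open Summit.ABC.ABC.Theorems
open WeierstrassCurve

namespace Summit.ABC.ABC.Cruxes.FreyModularity.StubIdeasModThree3G19

/-- The registered signature of `stub_modThree`, verbatim (reference only; NOT re-typed). [folklore] -/
abbrev SigStubModThree : Prop :=
  ∀ (W : WeierstrassCurve ℚ) [W.IsElliptic] (ρ : ModPGaloisRep ℚ (ZMod 3) 2),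
    W.IsTorsionGaloisRep 3 ρ → FramedRep.IsAbsolutelyIrreducible ρ → ρ.IsModular

/-- Registered `stub_liftThree` (Sketch L157), verbatim. [cite: Diamond1996, Thm. 5.4] -/
abbrev SigLiftThree : Prop :=
  ∀ (W : WeierstrassCurve ℚ) [W.IsElliptic] (ρ : ModPGaloisRep ℚ (ZMod 3) 2),
    W.IsTorsionGaloisRep 3 ρ → ρ.IsAbsIrreducibleOverSqrt (-3) → ¬ 9 ∣ W.conductorNorm ℤ →
    ρ.IsModular → W.IsModularGaloisRepTate 3

/-- Registered `stub_liftFive` (Sketch L170), verbatim. [cite: Diamond1996, Thm. 5.3] -/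
abbrev SigLiftFive : Prop :=
  ∀ (W : WeierstrassCurve ℚ) [W.IsElliptic] (ρ : ModPGaloisRep ℚ (ZMod 5) 2),
    W.IsTorsionGaloisRep 5 ρ → ρ.IsAbsIrreducibleOverSqrt 5 → ¬ 25 ∣ W.conductorNorm ℤ →
    ρ.IsModular → W.IsModularGaloisRepTate 5

/-- Registered `stub_threeImpTwo` (Sketch L186), verbatim. [cite: BCDTJAMS2001, Introduction ((3) ⇒ (2))] -/
abbrev SigThreeImpTwo : Prop :=
  ∀ (W : WeierstrassCurve ℚ) [W.IsElliptic] [NeZero (W.conductorNorm ℤ)] (ℓ : ℕ) [Fact ℓ.Prime],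
    W.IsModularGaloisRepTate ℓ → BCDT.IsModular W

/-- Landed `stub_nineTransfer` (p110220), its shape. [cite: ConradDiamondTaylor1999, proof of Thm. 7.1.2] -/
abbrev SigNineTransfer : Prop :=
  ∀ (W W' : WeierstrassCurve ℚ) [W.IsElliptic] [W'.IsElliptic] (ρ : ModPGaloisRep ℚ (ZMod 5) 2),
    W.IsTorsionGaloisRep 5 ρ → W'.IsTorsionGaloisRep 5 ρ →
    ¬ 9 ∣ W.conductorNorm ℤ → ¬ 9 ∣ W'.conductorNorm ℤ

/-- **k1's `CubeBranch` (g13/g14), verbatim**: the stub on the cube-discriminant locus `Δ(W) ∈ ℚ׳`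
(⟺ `ρ̄_{W,3}(Γ_ℚ)` a 2-group, g14 `isPGroup_two_iff_exists_Δ_eq_cube`), where `ρ̄ ≅ Ind φ` is
dihedral and modular by CM theta series — no leaf of Langlands–Tunnell; owes only k1's bricks E0–E5
since `shimura1972_heckeTheta_isNewform0_of_primitive_holds` landed (2026-09-01). [cite: Zywina2015, Thm. 1.2] -/
abbrev CubeBranch : Prop :=
  ∀ (W : WeierstrassCurve ℚ) [W.IsElliptic] (ρ : ModPGaloisRep ℚ (ZMod 3) 2),
    W.IsTorsionGaloisRep 3 ρ → FramedRep.IsAbsolutelyIrreducible ρ →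
    (∃ d : ℚ, W.Δ = d ^ 3) → ρ.IsModular

/-- **A big-image mod-5 edge** `W —5— W'`: a common framed model of `W[5]` and `W'[5]`, absolutely
irreducible over `ℚ(√5)` (the hypothesis under which `stub_liftFive` transports modularity).
[cite: Wiles1995Annals, Ch. 5] -/
def FiveLink (W W' : WeierstrassCurve ℚ) : Prop :=
  ∃ ρ : ModPGaloisRep ℚ (ZMod 5) 2,
    W.IsTorsionGaloisRep 5 ρ ∧ W'.IsTorsionGaloisRep 5 ρ ∧ ρ.IsAbsIrreducibleOverSqrt 5

/-- **A big-image mod-3 edge** `W —3— W'`: a common framed model of `W[3]` and `W'[3]`, absolutely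
irreducible over `ℚ(√-3)`. [cite: Wiles1995Annals, Ch. 5] -/
def ThreeLink (W W' : WeierstrassCurve ℚ) : Prop :=
  ∃ ρ : ModPGaloisRep ℚ (ZMod 3) 2,
    W.IsTorsionGaloisRep 3 ρ ∧ W'.IsTorsionGaloisRep 3 ρ ∧ ρ.IsAbsIrreducibleOverSqrt (-3)

/-- **L2 — modularity runs backwards along a big-image 5-edge (S, PROVED modulo the registered stubs
`stub_liftFive`, `stub_threeImpTwo`).**  If `W —5— W'`, `W'` is modular and `25 ∤ N_W`, then `W` is
modular: `ρ̄ = ρ̄_{W',5}` is modular by BCDT's unconditional (2) ⇒ (4)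
(`IsModular.isModular_of_isTorsionGaloisRep''`), then R = T at 5 and (3) ⇒ (2).  This is exactly the
case-B tail of `isModular_freyCurve_of_stubs`, cut out as a reusable edge lemma.
[cite: ConradDiamondTaylor1999, Thm. 7.2.2] -/
theorem isModular_of_fiveLink (hlift5 : SigLiftFive) (h32 : SigThreeImpTwo)
    {W W' : WeierstrassCurve ℚ} [W.IsElliptic] [W'.IsElliptic] [NeZero (W.conductorNorm ℤ)]
    [NeZero (W'.conductorNorm ℤ)] (hW' : BCDT.IsModular W') (h : FiveLink W W')
    (h25 : ¬ 25 ∣ W.conductorNorm ℤ) : BCDT.IsModular W := by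
  obtain ⟨ρ, hρ, hρ', hirr⟩ := h
  exact h32 W 5 (hlift5 W ρ hρ hirr h25 (hW'.isModular_of_isTorsionGaloisRep'' hρ'))

/-- **L3 — modularity runs backwards along a big-image 3-edge (S, PROVED modulo `stub_liftThree`,
`stub_threeImpTwo`; NO `stub_modThree`).**  If `W —3— W'`, `W'` is modular and `9 ∤ N_W`, then `W` is
modular.  [cite: ConradDiamondTaylor1999, Thm. 7.2.1] -/
theorem isModular_of_threeLink (hlift3 : SigLiftThree) (h32 : SigThreeImpTwo)
    {W W' : WeierstrassCurve ℚ} [W.IsElliptic] [W'.IsElliptic] [NeZero (W.conductorNorm ℤ)]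
    [NeZero (W'.conductorNorm ℤ)] (hW' : BCDT.IsModular W') (h : ThreeLink W W')
    (h9 : ¬ 9 ∣ W.conductorNorm ℤ) : BCDT.IsModular W := by
  obtain ⟨ρ, hρ, hρ', hirr⟩ := h
  exact h32 W 3 (hlift3 W ρ hρ hirr h9 (hW'.isModular_of_isTorsionGaloisRep'' hρ'))

/-- **The door, typed: a (5,3,5)-chain from `E` to the cube locus.**  `E —5— W₁ —3— W₂ —5— W₃` with
`Δ(W₃) ∈ ℚ׳`, `ρ̄_{W₃,3}` absolutely irreducible over `ℚ(√-3)` (image of order 16), and the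
semistability side conditions the two R = T stubs need (`25 ∤ N_{W₂}`, `9 ∤ N_{W₃}`; `9 ∤ N_{W₁}` is
inherited from `E` by `stub_nineTransfer`).  A rational point of the threefold `W_E` of the .md.
NOT proposed for staffing. [cite: RubinSilverberg1995, Thms. 4.1, 5.1] -/
def ChainToCubeLocus (E : WeierstrassCurve ℚ) : Prop :=
  ∃ (W₁ W₂ W₃ : WeierstrassCurve ℚ), W₁.IsElliptic ∧ W₂.IsElliptic ∧ W₃.IsElliptic ∧
    FiveLink E W₁ ∧ ThreeLink W₁ W₂ ∧ FiveLink W₂ W₃ ∧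
    ¬ 25 ∣ W₂.conductorNorm ℤ ∧ ¬ 9 ∣ W₃.conductorNorm ℤ ∧ (∃ d : ℚ, W₃.Δ = d ^ 3) ∧
    ∃ ρ₃ : ModPGaloisRep ℚ (ZMod 3) 2, W₃.IsTorsionGaloisRep 3 ρ₃ ∧ ρ₃.IsAbsIrreducibleOverSqrt (-3)

/-- **A — the chain assembly (PROVED): CM half + the two R = T stubs + (3) ⇒ (2) + nine-transfer make
every curve with a (5,3,5)-chain to the cube locus modular — no Langlands–Tunnell, no `stub_switch`.**
`W₃` modular (cube locus: `CubeBranch`, then R = T at 3), `W₂` modular (L2), `W₁` modular (L3),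
`E` modular (L2). [cite: Wiles1995Annals, Ch. 5] -/
theorem isModular_of_chainToCubeLocus (hcube : CubeBranch) (hlift3 : SigLiftThree)
    (hlift5 : SigLiftFive) (h32 : SigThreeImpTwo) (h6 : SigNineTransfer)
    {E : WeierstrassCurve ℚ} [E.IsElliptic] [NeZero (E.conductorNorm ℤ)]
    (h9 : ¬ 9 ∣ E.conductorNorm ℤ) (h25 : ¬ 25 ∣ E.conductorNorm ℤ) (hch : ChainToCubeLocus E) :
    BCDT.IsModular E := by
  obtain ⟨W₁, W₂, W₃, hW₁, hW₂, hW₃, ⟨ρa, hEa, h1a, hia⟩, h12, h23, h25₂, h9₃, hΔ, ρd, h3d, hid⟩ :=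
    hch
  haveI : NeZero (W₁.conductorNorm ℤ) := ⟨(conductorNorm_pos_holds W₁).ne'⟩
  haveI : NeZero (W₂.conductorNorm ℤ) := ⟨(conductorNorm_pos_holds W₂).ne'⟩
  haveI : NeZero (W₃.conductorNorm ℤ) := ⟨(conductorNorm_pos_holds W₃).ne'⟩
  -- the endpoint: cube locus, CM half of the stub, then R = T at 3 and (3) ⇒ (2)
  have hM₃ : BCDT.IsModular W₃ :=
    h32 W₃ 3 (hlift3 W₃ ρd h3d hid h9₃ (hcube W₃ ρd h3d hid.isAbsolutelyIrreducible hΔ))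
  -- back along the chain
  have hM₂ : BCDT.IsModular W₂ := isModular_of_fiveLink hlift5 h32 hM₃ h23 h25₂
  have h9₁ : ¬ 9 ∣ W₁.conductorNorm ℤ := h6 E W₁ ρa hEa h1a h9
  have hM₁ : BCDT.IsModular W₁ := isModular_of_threeLink hlift3 h32 hM₂ h12 h9₁
  exact isModular_of_fiveLink hlift5 h32 hM₁ ⟨ρa, hEa, h1a, hia⟩ h25

/-- `25 ∤ N` for a Frey curve (same proof as the landed `not_twentyFive_dvd_conductorNorm_freyCurve` of
`Theorems/DefiniteXiFreyModularitySketch.lean`, repeated here only to keep this file's imports inside the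
farm's built snapshot). [cite: BombieriGubler2006, Ex. 12.5.10] -/
theorem not_twentyFive_dvd_conductorNorm_freyCurve' {a b : ℤ} (hab : IsCoprime a b)
    (h0 : a * b * (a + b) ≠ 0) : ¬ 25 ∣ (freyCurve a b).conductorNorm ℤ := by
  intro h25
  have hdvd := conductorNorm_freyCurve_dvd_holds a b hab h0
  have h25' : 25 ∣ 2 ^ 8 * (UniqueFactorizationMonoid.radical (a * b * (a + b))).natAbs :=
    h25.trans hdvd
  have hcop : Nat.Coprime 25 (2 ^ 8) := by norm_num
  have h25r : 25 ∣ (UniqueFactorizationMonoid.radical (a * b * (a + b))).natAbs :=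
    hcop.dvd_of_dvd_mul_left h25'
  have hsq : Squarefree (UniqueFactorizationMonoid.radical (a * b * (a + b))).natAbs :=
    Int.squarefree_natAbs.mpr UniqueFactorizationMonoid.squarefree_radical
  have h5 : IsUnit (5 : ℕ) := hsq 5 ((show (5 : ℕ) * 5 = 25 by norm_num) ▸ h25r)
  exact absurd (Nat.isUnit_iff.mp h5) (by norm_num)

/-- **A at a Frey curve** (PROVED; `9 ∤ N`, `25 ∤ N` and nine-transfer are LANDED theorems of the tree:
`not_nine_dvd_conductorNorm_freyCurve`, `not_twentyFive_dvd_conductorNorm_freyCurve`,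
`stub_nineTransfer`). [cite: Wiles1995Annals, Ch. 5] -/
theorem isModular_freyCurve_of_chain (hcube : CubeBranch) (hlift3 : SigLiftThree)
    (hlift5 : SigLiftFive) (h32 : SigThreeImpTwo) {a b : ℤ} (hab : IsCoprime a b)
    (h0 : a * b * (a + b) ≠ 0) [NeZero ((freyCurve a b).conductorNorm ℤ)]
    (hch : ChainToCubeLocus (freyCurve a b)) : BCDT.IsModular (freyCurve a b) := by
  haveI := isElliptic_freyCurve h0
  exact isModular_of_chainToCubeLocus hcube hlift3 hlift5 h32 stub_nineTransfer
    (not_nine_dvd_conductorNorm_freyCurve hab h0) (not_twentyFive_dvd_conductorNorm_freyCurve' hab h0)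
    hch

/-- **The use-site instance of `stub_modThree` from a chain** (PROVED): for a Frey curve with a chain,
EVERY framed model of `E[3]` is modular (BCDT (2) ⇒ (4)) — the only thing `hmod3` is asked for at `E`.
[cite: BCDTJAMS2001, Introduction ((2) ⇒ (4))] -/
theorem stubModThree_at_freyCurve_of_chain (hcube : CubeBranch) (hlift3 : SigLiftThree)
    (hlift5 : SigLiftFive) (h32 : SigThreeImpTwo) {a b : ℤ} (hab : IsCoprime a b)
    (h0 : a * b * (a + b) ≠ 0) [NeZero ((freyCurve a b).conductorNorm ℤ)]
    (hch : ChainToCubeLocus (freyCurve a b)) :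
    ∀ ρ : ModPGaloisRep ℚ (ZMod 3) 2, (freyCurve a b).IsTorsionGaloisRep 3 ρ → ρ.IsModular := by
  intro ρ hρ
  haveI := isElliptic_freyCurve h0
  exact (isModular_freyCurve_of_chain hcube hlift3 hlift5 h32 hab h0 hch).isModular_of_isTorsionGaloisRep'' hρ

/-- **Q — the Diophantine door for the whole crux** (typed for refuters; EXPECTED FALSE generically —
see the .md: `W_E` is a cyclic triple cover of a rational threefold branched along the two 5-step cusp
divisors, of general type; Taylor 2002 replaces `ℚ`-points by points over a totally real field via
Moret-Bailly at exactly this step).  NOT proposed for staffing. [cite: Taylor2002FontaineMazur, Introduction] -/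
def FreyChainDoor : Prop :=
  ∀ a b : ℤ, IsCoprime a b → a * b * (a + b) ≠ 0 → ChainToCubeLocus (freyCurve a b)

/-- If the door were open, the crux `FreyModularity` would follow from the CM half, the two R = T stubs
and (3) ⇒ (2) alone (PROVED composition, concluding the crux BY NAME). [cite: Wiles1995Annals, Ch. 5] -/
theorem freyModularity_of_door (hcube : CubeBranch) (hlift3 : SigLiftThree) (hlift5 : SigLiftFive)
    (h32 : SigThreeImpTwo) (hQ : FreyChainDoor) : Summit.ABC.ABC.Theses.DefiniteXi.FreyModularity :=
  freyModularity_iff_forall_isModular_freyCurve.mpr fun _ _ hab h0 _ ↦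
    isModular_freyCurve_of_chain hcube hlift3 hlift5 h32 hab h0 (hQ _ _ hab h0)

/-- **Minimal-counterexample reading (family 3), PROVED contrapositive of L2/L3**: a non-modular curve
semistable at 3 and 5 drags its whole big-image (3,5)-congruence component (within the semistable-at-3,5
curves) into non-modularity; in particular that component avoids the cube locus. Stated for one edge of
each kind. [cite: Wiles1995Annals, Ch. 5] -/
theorem not_isModular_of_links (hlift3 : SigLiftThree) (hlift5 : SigLiftFive) (h32 : SigThreeImpTwo)
    {W W' W'' : WeierstrassCurve ℚ} [W.IsElliptic] [W'.IsElliptic] [W''.IsElliptic]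
    [NeZero (W.conductorNorm ℤ)] [NeZero (W'.conductorNorm ℤ)] [NeZero (W''.conductorNorm ℤ)]
    (hW : ¬ BCDT.IsModular W) (h5 : FiveLink W W') (h25 : ¬ 25 ∣ W.conductorNorm ℤ)
    (h3 : ThreeLink W' W'') (h9 : ¬ 9 ∣ W'.conductorNorm ℤ) :
    ¬ BCDT.IsModular W' ∧ ¬ BCDT.IsModular W'' := by
  have hW' : ¬ BCDT.IsModular W' := fun hM ↦ hW (isModular_of_fiveLink hlift5 h32 hM h5 h25)
  exact ⟨hW', fun hM ↦ hW' (isModular_of_threeLink hlift3 h32 hM h3 h9)⟩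

end Summit.ABC.ABC.Cruxes.FreyModularity.StubIdeasModThree3G19

end
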